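/-
Copyright (c) 2026 the pub-hodgecm-mathlib formalisation cell (harness21).  Prover seat hodgecm-mathlib-K2Liu-p10 (g4), Track B «K2-LIT»,
#184♮ = hLiu418 = `stmt-HodgeConjecture-24832`; (σ) endgame organ, SMALL SIDE, S-1 part 2c: THE MEASURE LETTER hμ of ★ (L2-a), generic.  KERNEL: theorems only.
-/
import Mathlib.MeasureTheory.Measure.Haar.Unique
import Mathlib.MeasureTheory.Group.Measure
import Mathlib.MeasureTheory.Integral.Bochner.Basic
import Mathlib.MeasureTheory.Constructions.BorelSpace.Basic
import Mathlib.MeasureTheory.Measure.Prod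
import Mathlib.Topology.Algebra.Module.Equiv
import HarnessLib

/-!
# Crux `HLiu418`, (σ) small side, S-1 part 2c: THE MEASURE LETTER hμ — the block-product Haar measure read through a frame

Cell `hodgecm-mathlib`, crux item hLiu418 = `stmt-HodgeConjecture-24832`, route of record `HCCMUnconditional`; squad K2 ∕ K2Liu, prover K2Liu-p10 (g4).
THEOREMS ONLY; lane `--supports stmt-HodgeConjecture-24832 --as helper`.  Generic: a second-countable Borel topological additive group `K` (at a finite place: `F_v`
with ★ `secondCountableTopology_adicCompletion`), finite index types `ι β α`, a frame `θ : K^ι ≃ₜ K^{(β⊕α)⊕α}`.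

★ (L2-a) `exists_krMap_toRep_weyl` ∕ ★ β-2 `krFun_betaFourier_eq` take the measure letter
`hμ : ∀ H, ∫ x, H x ∂μX = ∫ t, H (θ⁻¹((t.2.1 ⊔ t.1) ⊔ t.2.2)) ∂(μ ⊗ (ν_β ⊗ μ))` BY VALUE.  With **`μX := Measure.map (t ↦ θ⁻¹((t.2.1 ⊔ t.1) ⊔ t.2.2)) (μ ⊗ (ν_β ⊗ μ))`** it is a
THEOREM (**`integral_map_frame`**, change of variables along a measurable equivalence), and that `μX` IS an additive Haar measure when `θ` is additive and `μ`, `ν_β` are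
(**`isAddHaarMeasure_map_frame`**) — so the instance (★ S-0a `krFrameTw`, additive by `krFrameTw_add`) discharges hμ and the `[μX.IsAddHaarMeasure]` binder at once.
§1 builds the block rearrangement `(α→K) × ((β→K) × (α→K)) ≃ₜ ((β⊕α)⊕α → K)` and the composite measurable equivalence.

HONEST LABEL: HC_CM is proved only modulo the 7 printed citations (2 remaining named inputs: hLiu418 = stmt-HodgeConjecture-24832, h413 = stmt-HodgeConjecture-24833)
until rung 0 closes; helper, closes no item.
References: [KudlaRallis1994] §1 (the mixed model integral); [MoeglinVignerasWaldspurger1987] Chap. 2 II.6; [Weil1964] n° 13.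
-/

set_option autoImplicit false
set_option linter.dupNamespace false -- the mandated namespace repeats `HodgeConjecture.HodgeConjecture`

noncomputable section

open MeasureTheory

namespace Summit.HodgeConjecture.HodgeConjecture.Cruxes.HLiu418.K2LiuKRFrameMeasureLetter

variable {K : Type*} [TopologicalSpace K] {ι β α : Type*}

/-! ## §1 The block rearrangement -/

/-- the block rearrangement `t ↦ (t.2.1 ⊔ t.1) ⊔ t.2.2` is continuous. [folklore] -/
theorem continuous_blocks : Continuous fun t : (α → K) × ((β → K) × (α → K)) => Sum.elim (Sum.elim t.2.1 t.1) t.2.2 := by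
  refine continuous_pi fun s => ?_
  rcases s with (b | a) | a
  · exact (continuous_apply b).comp (continuous_fst.comp continuous_snd)
  · exact (continuous_apply a).comp continuous_fst
  · exact (continuous_apply a).comp (continuous_snd.comp continuous_snd)

/-- its inverse `f ↦ (f ∘ inl ∘ inr, (f ∘ inl ∘ inl, f ∘ inr))` is continuous. [folklore] -/
theorem continuous_blocks_symm :
    Continuous fun f : (β ⊕ α) ⊕ α → K => ((fun a => f (Sum.inl (Sum.inr a))), ((fun b => f (Sum.inl (Sum.inl b))), fun a => f (Sum.inr a))) :=
  (continuous_pi fun _ => continuous_apply _).prodMk ((continuous_pi fun _ => continuous_apply _).prodMk (continuous_pi fun _ => continuous_apply _))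

/-- the block rearrangement as a homeomorphism (statement-free helper, used only inside proofs). [folklore] -/
theorem exists_homeomorph_blocks :
    ∃ e : ((α → K) × ((β → K) × (α → K))) ≃ₜ ((β ⊕ α) ⊕ α → K), ∀ t, e t = Sum.elim (Sum.elim t.2.1 t.1) t.2.2 :=
  ⟨{ toFun := fun t => (Sum.elim (Sum.elim t.2.1 t.1) t.2.2),
      invFun := fun f => ((fun a => f (Sum.inl (Sum.inr a))), ((fun b => f (Sum.inl (Sum.inl b))), fun a => f (Sum.inr a))),
      left_inv := fun t => rfl,
      right_inv := fun f => by funext s; rcases s with (b | a) | a <;> rfl,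
      continuous_toFun := continuous_blocks,
      continuous_invFun := continuous_blocks_symm }, fun _ => rfl⟩

/-! ## §2 The measure letter -/

variable [Fintype ι] [Fintype β] [Fintype α] [MeasurableSpace K] [BorelSpace K] [SecondCountableTopology K]

/-- **THE MEASURE LETTER hμ** of ★ (L2-a): with `μX := map (t ↦ θ⁻¹((t.2.1 ⊔ t.1) ⊔ t.2.2)) (μ ⊗ (ν_β ⊗ μ))`, for EVERY `H`,
`∫ x, H x ∂μX = ∫ t, H (θ⁻¹((t.2.1 ⊔ t.1) ⊔ t.2.2)) ∂(μ ⊗ (ν_β ⊗ μ))` (change of variables along a measurable equivalence; no measurability of `H` needed).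
[cite: KudlaRallis1994, §1] [cite: MoeglinVignerasWaldspurger1987, Chap. 2 II.6] -/
theorem integral_map_frame (θ : (ι → K) ≃ₜ ((β ⊕ α) ⊕ α → K)) (μ : Measure (α → K)) (νβ : Measure (β → K)) (H : (ι → K) → ℂ) :
    ∫ x, H x ∂(Measure.map (fun t : (α → K) × ((β → K) × (α → K)) => θ.symm (Sum.elim (Sum.elim t.2.1 t.1) t.2.2)) (μ.prod (νβ.prod μ))) =
      ∫ t : (α → K) × ((β → K) × (α → K)), H (θ.symm (Sum.elim (Sum.elim t.2.1 t.1) t.2.2)) ∂(μ.prod (νβ.prod μ)) := by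
  obtain ⟨e, he⟩ := exists_homeomorph_blocks (K := K) (β := β) (α := α)
  have hfun : (fun t : (α → K) × ((β → K) × (α → K)) => θ.symm (Sum.elim (Sum.elim t.2.1 t.1) t.2.2)) = ⇑((e.trans θ.symm).toMeasurableEquiv) := by
    funext t
    simp only [Homeomorph.toMeasurableEquiv_coe, Homeomorph.trans_apply, he]
  rw [hfun, integral_map_equiv]
  exact congrArg (MeasureTheory.integral _) (funext fun t => congrArg H (congrFun hfun t).symm)

variable [AddCommGroup K] [IsTopologicalAddGroup K] [LocallyCompactSpace K]

/-- **THE HAAR BINDER**: that `μX` is an additive Haar measure when `θ` is additive and `μ`, `ν_β` are Haar. [cite: Weil1964, n° 13] -/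
theorem isAddHaarMeasure_map_frame (θ : (ι → K) ≃ₜ ((β ⊕ α) ⊕ α → K)) (hθ : ∀ x y, θ (x + y) = θ x + θ y)
    (μ : Measure (α → K)) [μ.IsAddHaarMeasure] (νβ : Measure (β → K)) [νβ.IsAddHaarMeasure] :
    (Measure.map (fun t : (α → K) × ((β → K) × (α → K)) => θ.symm (Sum.elim (Sum.elim t.2.1 t.1) t.2.2)) (μ.prod (νβ.prod μ))).IsAddHaarMeasure := by
  obtain ⟨e, he⟩ := exists_homeomorph_blocks (K := K) (β := β) (α := α)
  -- the composite as an additive equivalence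
  have hθs : ∀ x y, θ.symm (x + y) = θ.symm x + θ.symm y := fun x y => by
    apply θ.injective; rw [hθ, θ.apply_symm_apply, θ.apply_symm_apply, θ.apply_symm_apply]
  have headd : ∀ s t, e (s + t) = e s + e t := fun s t => by
    rw [he, he, he]; funext k; rcases k with (b | a) | a <;> rfl
  let A : ((α → K) × ((β → K) × (α → K))) ≃+ (ι → K) :=
    { toEquiv := (e.trans θ.symm).toEquiv
      map_add' := fun s t => by
        show θ.symm (e (s + t)) = θ.symm (e s) + θ.symm (e t)
        rw [headd, hθs] }
  have hfun : (fun t : (α → K) × ((β → K) × (α → K)) => θ.symm (Sum.elim (Sum.elim t.2.1 t.1) t.2.2)) = ⇑A := by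
    funext t
    show θ.symm _ = θ.symm (e t)
    rw [he]
  rw [hfun]
  haveI h1 : (νβ.prod μ).IsAddHaarMeasure := inferInstance
  haveI h2 : SFinite (νβ.prod μ) := inferInstance
  haveI h3 : MeasurableAdd ((β → K) × (α → K)) := inferInstance
  haveI h4 : (μ.prod (νβ.prod μ)).IsAddHaarMeasure := Measure.prod.instIsAddHaarMeasure μ (νβ.prod μ)
  exact AddEquiv.isAddHaarMeasure_map _ A (e.trans θ.symm).continuous (e.trans θ.symm).symm.continuous

end Summit.HodgeConjecture.HodgeConjecture.Cruxes.HLiu418.K2LiuKRFrameMeasureLetter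

end
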